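import Literature.AlgebraicGeometry.KTheory.EulerCharacteristic
import Mathlib.Algebra.Homology.Embedding.CochainComplex
import HarnessLib

/-!
# The canonical truncation `τ^{≤m} K` of a bounded complex of vector bundles at (or above) its top cohomology degree
# is again a bounded complex of vector bundles, with the same Euler characteristic

Layer `Literature/AlgebraicGeometry/KTheory` (0 named facts, no instances); sequel to `KTheory/EulerCharacteristic`
(`IsBoundedVBComplex`, `eulerChar`, `IsBoundedVBComplex.isFiniteLocallyFree_kernel` for ACYCLIC complexes,
`eulerChar_eq_of_quasiIso`). For a scheme `X` and a bounded cochain complex `K` of finite locally free `𝒪_X`-modules which is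
cohomologically `≤ m` (Mathlib `CochainComplex.IsLE`: exact in every degree `> m`):

* `IsBoundedVBComplex.isFiniteLocallyFree_kernel_of_exactAt` — the cycles `Zⁱ = ker dⁱ` are vector bundles for every `i ≥ m`
  (descending induction on the exact TAIL `Kᵐ → Kᵐ⁺¹ → ⋯ → Kᵇ → 0`: `Zⁱ = ker(Kⁱ ↠ Zⁱ⁺¹)` is the kernel of an epimorphism of
  vector bundles, `Modules.isFiniteLocallyFree_kernel`, Stacks 05P2), `isFiniteLocallyFree_cycles` (Mathlib's `K.cycles i`);
* `IsBoundedVBComplex.truncLE` — Mathlib's canonical truncation `K.truncLE m = (⋯ → Kᵐ⁻¹ → Zᵐ → 0)` is a bounded complex of vector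
  bundles, and `eulerChar_truncLE : χ(τ^{≤m} K) = χ(K)` in `K₀(X)` (the inclusion `K.ιTruncLE m` is a quasi-isomorphism, Mathlib
  `CochainComplex.quasiIso_ιTruncLE_iff`, and `χ` is a quasi-isomorphism invariant).

This is the first step («replace a vector-bundle model by one with no terms above its top cohomology degree») of the amplitude
induction by which the Euler characteristic ∕ Chern character of a bounded vector-bundle complex is shown to depend only on its
class in the derived category (files `KTheory/AdaptedResolution`, `KTheory/EulerCharOfDerivedIso`), and the truncation by which a
vector-bundle model with cohomology in one degree becomes a strictly perfect RESOLUTION (`Modules/StrictlyPerfectResolutionOfVBModel`).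
Everything is proved; Mathlib searched (pin): `HomologicalComplex.truncLEXIso`, `truncLEXIsoCycles`, `boundaryLE_embeddingUpIntLE_iff`,
`CochainComplex.isZero_of_isStrictlyLE`, `cyclesIsKernel` (used; `Zⁱ = ker dⁱ ≅ K.cycles i` by `IsLimit.conePointUniqueUpToIso`). Research route conditional on HC_CM; not a corollary; nothing here
refers to it.

## References

* M. Schlichting, *Higher algebraic K-theory*, LNM 2008 (2011), §3.1.3–3.1.4 (strictly acyclic complexes in an exact category;
  `K₀` of bounded complexes). [Schlichting2011HigherKTheory]
* R. W. Thomason, T. Trobaugh, *Higher algebraic K-theory of schemes and of derived categories* (1990), 1.9.x–2.2.x (truncations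
  of (strict) perfect complexes). [ThomasonTrobaugh1990]
* The Stacks Project, Tag 05P2 (kernel of an epimorphism of finite locally free modules), Tag 0118 (canonical truncations). [StacksProject]
-/

universe u

open CategoryTheory CategoryTheory.Limits AlgebraicGeometry ZeroObject ComplexShape
open Literature.AlgebraicGeometry.Motives

noncomputable section

namespace Literature.AlgebraicGeometry.KTheory

/-! ## Cycles above the top cohomology degree -/

section Kernels

variable {C : Type*} [Category C] [Abelian C] {K : CochainComplex C ℤ}

/-- If `K` is exact in degree `i+1`, the corestriction `Kⁱ → Zⁱ⁺¹ = ker dⁱ⁺¹` of `dⁱ` is an epimorphism. [cite: StacksProject, Tag 0118] -/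
theorem epi_kernelLift_of_exactAt {i : ℤ} (h : K.ExactAt (i + 1)) :
    Epi (kernel.lift (K.d (i + 1) (i + 1 + 1)) (K.d i (i + 1)) (K.d_comp_d _ _ _)) :=
  ((K.exactAt_iff' i (i + 1) (i + 1 + 1) (by simp) (by simp)).1 h).epi_kernelLift

end Kernels

namespace IsBoundedVBComplex

variable {X : Scheme.{u}} {K : CochainComplex X.Modules ℤ}

/-- **The cycles of a bounded complex of vector bundles above its top cohomology degree are vector bundles**: if `K` is exact in
every degree `> m`, then `Zⁱ = ker dⁱ` is finite locally free for every `i ≥ m` — by descending induction from the top, `Zⁱ` being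
the kernel of the epimorphism `Kⁱ ↠ Zⁱ⁺¹` of vector bundles (exactness at `i+1`). The acyclic case is
`IsBoundedVBComplex.isFiniteLocallyFree_kernel`. [cite: Schlichting2011HigherKTheory, §3.1.3] [cite: StacksProject, Tag 05P2] -/
theorem isFiniteLocallyFree_kernel_of_exactAt (hK : IsBoundedVBComplex K) (m : ℤ) (hex : ∀ i, m < i → K.ExactAt i)
    (i : ℤ) (hi : m ≤ i) : IsFiniteLocallyFree (kernel (K.d i (i + 1))) := by
  obtain ⟨b, hb⟩ := hK.exists_isZero_of_lt
  -- above the bound the kernels are zero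
  have htop : ∀ i, b < i → IsFiniteLocallyFree (kernel (K.d i (i + 1))) := fun i hi ↦
    KZero.isFiniteLocallyFree_of_isZero (IsZero.of_mono (kernel.ι _) (hb i hi))
  -- the inductive step, valid in degrees `≥ m` (exactness at `i + 1 > m`)
  have hstep : ∀ i, m ≤ i → IsFiniteLocallyFree (kernel (K.d (i + 1) (i + 1 + 1))) →
      IsFiniteLocallyFree (kernel (K.d i (i + 1))) := by
    intro i hmi hi
    have := epi_kernelLift_of_exactAt (hex (i + 1) (by omega))
    have hk := Modules.isFiniteLocallyFree_kernel
      (kernel.lift (K.d (i + 1) (i + 1 + 1)) (K.d i (i + 1)) (K.d_comp_d _ _ _))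
      (hK.isFiniteLocallyFree i) hi
    refine Modules.isFiniteLocallyFree_of_iso ?_ hk
    exact (kernelCompMono _ (kernel.ι (K.d (i + 1) (i + 1 + 1)))).symm ≪≫
      kernelIsoOfEq (kernel.lift_ι _ _ _)
  -- descending induction from the bound
  have hind : ∀ n : ℕ, ∀ i : ℤ, m ≤ i → i = b - n → IsFiniteLocallyFree (kernel (K.d i (i + 1))) := by
    intro n
    induction n with
    | zero =>
      intro i hmi hi
      exact hstep i hmi (htop (i + 1) (by omega))
    | succ n ih =>
      intro i hmi hi
      exact hstep i hmi (ih (i + 1) (by omega) (by omega))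
  by_cases hbi : b < i
  · exact htop i hbi
  · exact hind (b - i).toNat i hi (by omega)

/-- **`Zⁱ(K)` is a vector bundle for `i ≥ m` when `K` is a bounded VB complex cohomologically `≤ m`** (Mathlib's `K.cycles`,
`CochainComplex.IsLE`). [cite: Schlichting2011HigherKTheory, §3.1.3] [cite: StacksProject, Tag 05P2] -/
theorem isFiniteLocallyFree_cycles (hK : IsBoundedVBComplex K) (m : ℤ) [K.IsLE m] (i : ℤ) (hi : m ≤ i) :
    IsFiniteLocallyFree (K.cycles i) :=
  Modules.isFiniteLocallyFree_of_iso
    ((kernelIsKernel (K.d i (i + 1))).conePointUniqueUpToIso (K.cyclesIsKernel i (i + 1) (by simp)))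
    (hK.isFiniteLocallyFree_kernel_of_exactAt m (fun j hj ↦ K.exactAt_of_isLE m j hj) i hi)

/-! ## The canonical truncation `τ^{≤m}` -/

/-- The terms of `τ^{≤m} K` below `m` are those of `K`. [cite: StacksProject, Tag 0118 (canonical truncations)] -/
theorem nonempty_truncLE_X_iso (K : CochainComplex X.Modules ℤ) (m i : ℤ) (hi : i < m) :
    Nonempty ((K.truncLE m).X i ≅ K.X i) :=
  ⟨HomologicalComplex.truncLEXIso K (embeddingUpIntLE m) (i := (m - i).toNat) (by simp; omega)
    (by rw [boundaryLE_embeddingUpIntLE_iff]; omega)⟩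

/-- The term of `τ^{≤m} K` in degree `m` is `Zᵐ(K)`. [cite: StacksProject, Tag 0118] -/
theorem nonempty_truncLE_X_iso_cycles (K : CochainComplex X.Modules ℤ) (m : ℤ) :
    Nonempty ((K.truncLE m).X m ≅ K.cycles m) :=
  ⟨HomologicalComplex.truncLEXIsoCycles K (embeddingUpIntLE m) (i := 0) (by simp)
    (by rw [boundaryLE_embeddingUpIntLE_iff])⟩

/-- **`τ^{≤m} K` is a bounded complex of vector bundles** when `K` is one and is cohomologically `≤ m`: its terms are `Kⁱ` (`i < m`),
the vector bundle `Zᵐ(K)` (`i = m`, `isFiniteLocallyFree_cycles`) and `0` (`i > m`). [cite: ThomasonTrobaugh1990, 1.9.x–2.2.x]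
[cite: Schlichting2011HigherKTheory, §3.1.3] -/
theorem truncLE (hK : IsBoundedVBComplex K) (m : ℤ) [K.IsLE m] : IsBoundedVBComplex (K.truncLE m) := by
  have hgt : ∀ i : ℤ, m < i → IsZero ((K.truncLE m).X i) := fun i hi ↦ (K.truncLE m).isZero_of_isStrictlyLE m i hi
  obtain ⟨s, hs⟩ := hK.exists_finset
  refine ⟨fun i ↦ ?_, ⟨s, fun i hi ↦ ?_⟩⟩
  · rcases lt_trichotomy i m with h | rfl | h
    · exact Modules.isFiniteLocallyFree_of_iso (nonempty_truncLE_X_iso K m i h).some.symm (hK.isFiniteLocallyFree i)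
    · exact Modules.isFiniteLocallyFree_of_iso (nonempty_truncLE_X_iso_cycles K i).some.symm
        (hK.isFiniteLocallyFree_cycles i i le_rfl)
    · exact KZero.isFiniteLocallyFree_of_isZero (hgt i h)
  · rcases lt_trichotomy i m with h | rfl | h
    · exact (hs i hi).of_iso (nonempty_truncLE_X_iso K m i h).some
    · exact (IsZero.of_mono (K.iCycles i) (hs i hi)).of_iso (nonempty_truncLE_X_iso_cycles K i).some
    · exact hgt i h

/-- **`χ(τ^{≤m} K) = χ(K)` in `K₀(X)`**: the inclusion `τ^{≤m} K ⟶ K` is a quasi-isomorphism (`K` is cohomologically `≤ m`) of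
bounded complexes of vector bundles. [cite: Schlichting2011HigherKTheory, Exercise 3.1.4] -/
theorem eulerChar_truncLE (hK : IsBoundedVBComplex K) (m : ℤ) [K.IsLE m] :
    eulerChar (K.truncLE m) (hK.truncLE m).isFiniteLocallyFree = eulerChar K hK.isFiniteLocallyFree :=
  (hK.truncLE m).eulerChar_eq_of_quasiIso hK (K.ιTruncLE m)

end IsBoundedVBComplex

end Literature.AlgebraicGeometry.KTheory

end
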